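import Literature.Topology.FourManifolds.CompactlySupportedDiffeo
import HarnessLib

/-!
# Linear automorphisms of `ℝⁿ` with positive determinant are compactly straightenable

Topic `Literature/Topology/FourManifolds`, companion to `CompactlySupportedDiffeo.lean`, §4
(`Literature.IsStraightenable X`: the continuous linear map `X` agrees near `0` with a diffeomorphism of
`ℝⁿ` which is the identity outside a bounded set; transvections, positive diagonal maps, products
and conjugates are straightenable, and `Literature.Topology.FourManifolds.exists_linearIsometryEquiv_isStraightenable_comp`:
every automorphism `L` becomes straightenable after composing with a coordinate reflection
`diag(±1)`). This file removes the reflection when `det L > 0`: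

* `Literature.Topology.FourManifolds.isStraightenable_of_det_pos` — a linear automorphism of `ℝⁿ` with positive determinant is
  compactly straightenable.

This is the role of the connectedness of `GL⁺(n, ℝ)` in the disc theorem (M. W. Hirsch,
*Differential Topology* (1976), Ch. 8 §3, proof of Thm. 3.1: an orientation-preserving embedding of
the disc is isotoped until its differential at the centre is the identity, `GL⁺` being connected),
made constructive: by Gaussian elimination `L = P · diag(d) · P'` with `P`, `P'` products of
transvections (`Matrix.Pivot.exists_list_transvec_mul_diagonal_mul_list_transvec`);
`diag(d) = diag(|d|) · diag(σ)` with `σᵢ = sign dᵢ`, and `det L > 0` forces an even number of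
`-1`'s; a pair of `-1`'s is the half turn of a coordinate plane, the square of the quarter turn
`J = τᵢⱼ(1) τⱼᵢ(-1) τᵢⱼ(1)` — a product of transvections (`Literature.Topology.FourManifolds.transvectionQuarterTurn_sq`) — hence
straightenable. Written for brick B3 (Palais' disc theorem on a general connected manifold,
without the isometry slack of `Literature.Topology.FourManifolds.exists_diffeomorph_apply_stereographic_symm_eq`) of leaf (iv),
uniqueness of oriented connected sums, of the decomposition of Kervaire–Milnor's Theorem 1.1
(`Literature.Topology.FourManifolds.exists_commGroup_homotopySphereClass`).

## References

* M. W. Hirsch, *Differential Topology*, GTM 33 (1976), Ch. 8 §3, Thm. 3.1. [HirschDT1976]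
-/

open scoped Manifold ContDiff Topology
open Set Function Matrix

noncomputable section

namespace Literature.Topology.FourManifolds

variable {ι : Type*} [Fintype ι] [DecidableEq ι]

/-- The **quarter turn** of the `(i, j)` coordinate plane (`eᵢ ↦ -eⱼ`, `eⱼ ↦ eᵢ`, other basis
vectors fixed; `i ≠ j`), written as the product of transvections `τᵢⱼ(1) τⱼᵢ(-1) τᵢⱼ(1)`
(the classical factorisation of the rotation by `-π/2` of `SL₂(ℤ)` into elementary matrices).
[folklore] -/
def transvectionQuarterTurn (i j : ι) : Matrix ι ι ℝ :=
  transvection i j 1 * transvection j i (-1) * transvection i j 1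

omit [Fintype ι] in
/-- `τᵢⱼ(-1) = 1 - Eᵢⱼ`. [folklore] -/
theorem transvection_neg_one_eq (i j : ι) :
    transvection i j (-1 : ℝ) = 1 - Matrix.single i j 1 := by
  rw [transvection, sub_eq_add_neg]
  congr 1
  ext a b
  simp only [Matrix.single_apply, Matrix.neg_apply]
  split_ifs <;> norm_num

/-- `τᵢⱼ(1) τⱼᵢ(-1) τᵢⱼ(1) = 1 - Eᵢᵢ - Eⱼⱼ + Eᵢⱼ - Eⱼᵢ` for `i ≠ j` (matrix units `E`; expand with
`Eₐᵦ E_bc = Eₐc`, `Eₐᵦ E_cd = 0` for `b ≠ c`). [folklore] -/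
theorem transvectionQuarterTurn_eq {i j : ι} (hij : i ≠ j) :
    transvectionQuarterTurn i j =
      1 - Matrix.single i i (1 : ℝ) - Matrix.single j j 1 + Matrix.single i j 1 - Matrix.single j i 1 := by
  have hji : j ≠ i := hij.symm
  rw [transvectionQuarterTurn, transvection_neg_one_eq, transvection]
  simp only [mul_add, add_mul, mul_sub, sub_mul, mul_one, one_mul,
    Matrix.single_mul_single_same, Matrix.single_mul_single_of_ne (c := (1:ℝ)) _ _ _ hji]
  abel

/-- **The square of the quarter turn is the half turn**: `J² = 1 - 2Eᵢᵢ - 2Eⱼⱼ`, the rotation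
by `π` of the `(i, j)` plane. [folklore] -/
theorem transvectionQuarterTurn_sq {i j : ι} (hij : i ≠ j) :
    transvectionQuarterTurn i j * transvectionQuarterTurn i j =
      1 - Matrix.single i i (1 : ℝ) - Matrix.single i i 1 - Matrix.single j j 1 - Matrix.single j j 1 := by
  have hji : j ≠ i := hij.symm
  rw [transvectionQuarterTurn_eq hij]
  simp only [mul_add, add_mul, mul_sub, sub_mul, mul_one, one_mul,
    Matrix.single_mul_single_same, Matrix.single_mul_single_of_ne (c := (1:ℝ)) _ _ _ hij,
    Matrix.single_mul_single_of_ne (c := (1:ℝ)) _ _ _ hji]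
  abel

omit [Fintype ι] in
/-- The half turn of the `(i, j)` plane as a sign diagonal matrix: `diag(σ)` with `σ = -1` at
`i, j` and `1` elsewhere equals `1 - 2Eᵢᵢ - 2Eⱼⱼ`. [folklore] -/
theorem diagonal_neg_pair_eq {i j : ι} (hij : i ≠ j) :
    diagonal (fun k => if k = i ∨ k = j then (-1 : ℝ) else 1) =
      1 - Matrix.single i i (1 : ℝ) - Matrix.single i i 1 - Matrix.single j j 1 - Matrix.single j j 1 := by
  have hji : j ≠ i := hij.symm
  ext a b
  simp only [diagonal_apply, Matrix.sub_apply, Matrix.one_apply, Matrix.single_apply]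
  by_cases hab : a = b
  · subst hab
    by_cases hai : a = i
    · subst hai
      simp only [true_or, if_true, and_self, hji, if_false]
      norm_num
    · by_cases haj : a = j
      · subst haj
        simp only [or_true, if_true, and_self, Ne.symm hai, if_false]
        norm_num
      · simp only [hai, haj, or_self, if_false, if_true, Ne.symm hai, Ne.symm haj, false_and]
        norm_num
  · have h1 : ¬(i = a ∧ i = b) := fun h => hab (h.1.symm.trans h.2)
    have h2 : ¬(j = a ∧ j = b) := fun h => hab (h.1.symm.trans h.2)
    simp only [hab, if_false, h1, h2]
    norm_num

/-- **The rotation by `π` of a coordinate plane is straightenable**: it is the square of the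
quarter turn, a product of (straightenable) transvections
(`Literature.Topology.FourManifolds.isStraightenable_toEuclideanCLM_transvection`). [folklore] -/
theorem isStraightenable_toEuclideanCLM_diagonal_neg_pair {i j : ι} (hij : i ≠ j) :
    IsStraightenable (Matrix.toEuclideanCLM (n := ι) (𝕜 := ℝ)
      (diagonal (fun k => if k = i ∨ k = j then (-1 : ℝ) else 1))) := by
  rw [diagonal_neg_pair_eq hij, ← transvectionQuarterTurn_sq hij, map_mul]
  have hJ : IsStraightenable (Matrix.toEuclideanCLM (n := ι) (𝕜 := ℝ)
      (transvectionQuarterTurn i j)) := by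
    rw [transvectionQuarterTurn, map_mul, map_mul]
    exact ((isStraightenable_toEuclideanCLM_transvection hij 1).mul
      (isStraightenable_toEuclideanCLM_transvection hij.symm (-1))).mul
      (isStraightenable_toEuclideanCLM_transvection hij 1)
  exact hJ.mul hJ

/-- **A sign diagonal matrix with an even number of `-1`'s is straightenable**: pair the `-1`'s
into half turns of coordinate planes (induction on the number of pairs). [folklore] -/
theorem isStraightenable_toEuclideanCLM_diagonal_sign_aux :
    ∀ (m : ℕ) (s : Finset ι), s.card = 2 * m →
      IsStraightenable (Matrix.toEuclideanCLM (n := ι) (𝕜 := ℝ)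
        (diagonal fun k => if k ∈ s then (-1 : ℝ) else 1)) := by
  intro m
  induction m with
  | zero =>
    intro s hs
    have hs' : s = ∅ := Finset.card_eq_zero.mp (by simpa using hs)
    subst hs'
    have : (diagonal fun k : ι => if k ∈ (∅ : Finset ι) then (-1 : ℝ) else 1) = 1 := by
      simp
    rw [this, map_one]
    exact IsStraightenable.one
  | succ m ih =>
    intro s hs
    have hcard : 0 < s.card := by omega
    obtain ⟨i, hi⟩ := Finset.card_pos.mp hcard
    have hcard₁ : 0 < (s.erase i).card := by rw [Finset.card_erase_of_mem hi]; omega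
    obtain ⟨j, hj⟩ := Finset.card_pos.mp hcard₁
    have hji : j ≠ i := Finset.ne_of_mem_erase hj
    have hjs : j ∈ s := Finset.mem_of_mem_erase hj
    set s' := (s.erase i).erase j with hs'_def
    have hs' : s'.card = 2 * m := by
      rw [hs'_def, Finset.card_erase_of_mem hj, Finset.card_erase_of_mem hi]
      omega
    have hsplit : (diagonal fun k : ι => if k ∈ s then (-1 : ℝ) else 1) =
        (diagonal fun k => if k ∈ s' then (-1 : ℝ) else 1) *
          diagonal (fun k => if k = i ∨ k = j then (-1 : ℝ) else 1) := by
      rw [diagonal_mul_diagonal]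
      congr 1
      funext k
      by_cases hki : k = i
      · subst hki
        have : k ∉ s' := by simp [hs'_def]
        simp [hi, this]
      · by_cases hkj : k = j
        · subst hkj
          have : k ∉ s' := by simp [hs'_def]
          simp [hjs, this]
        · have : k ∈ s' ↔ k ∈ s := by simp [hs'_def, hki, hkj]
          simp [this, hki, hkj]
    rw [hsplit, map_mul]
    exact (ih s' hs').mul (isStraightenable_toEuclideanCLM_diagonal_neg_pair hji.symm)

/-- **Every linear automorphism of `ℝⁿ` with positive determinant is compactly straightenable**
(the constructive content of "`GL⁺(n, ℝ)` is connected" in Hirsch, *Differential Topology* (1976),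
Ch. 8 §3, proof of Thm. 3.1): by Gaussian elimination `L = P · diag(d) · P'` with `P`, `P'`
products of transvections (`Matrix.Pivot.exists_list_transvec_mul_diagonal_mul_list_transvec`,
transvections having determinant `1`), so `∏ dᵢ = det L > 0` and the negative `dᵢ` come in
pairs; `diag(d) = diag(|d|) · diag(σ)` with `diag(|d|)` straightenable
(`Literature.Topology.FourManifolds.isStraightenable_toEuclideanCLM_diagonal`) and `diag(σ)` a product of half turns
(`isStraightenable_toEuclideanCLM_diagonal_sign_aux`). [cite: HirschDT1976, Ch. 8 §3 Thm. 3.1] -/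
theorem isStraightenable_of_det_pos (L : EuclideanSpace ℝ ι ≃L[ℝ] EuclideanSpace ℝ ι)
    (hL : 0 < LinearMap.det ((L : EuclideanSpace ℝ ι →L[ℝ] EuclideanSpace ℝ ι) :
      EuclideanSpace ℝ ι →ₗ[ℝ] EuclideanSpace ℝ ι)) :
    IsStraightenable (L : EuclideanSpace ℝ ι →L[ℝ] EuclideanSpace ℝ ι) := by
  set T := Matrix.toEuclideanCLM (n := ι) (𝕜 := ℝ) with hT
  set M : Matrix ι ι ℝ := T.symm (L : EuclideanSpace ℝ ι →L[ℝ] EuclideanSpace ℝ ι) with hM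
  have hTM : T M = (L : EuclideanSpace ℝ ι →L[ℝ] EuclideanSpace ℝ ι) := by simp [hM]
  obtain ⟨P, P', D, hMD⟩ := Pivot.exists_list_transvec_mul_diagonal_mul_list_transvec M
  -- `det M = det L > 0`
  have hdetM : M.det = LinearMap.det ((L : EuclideanSpace ℝ ι →L[ℝ] EuclideanSpace ℝ ι) :
      EuclideanSpace ℝ ι →ₗ[ℝ] EuclideanSpace ℝ ι) := by
    rw [← hTM, Matrix.coe_toEuclideanCLM_eq_toEuclideanLin, Matrix.toEuclideanLin_eq_toLin_orthonormal,
      LinearMap.det_toLin]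
  have hdetD : (∏ i, D i) = M.det := by
    rw [hMD, det_mul, det_mul, TransvectionStruct.det_toMatrix_prod,
      TransvectionStruct.det_toMatrix_prod, det_diagonal, one_mul, mul_one]
  have hprod : 0 < ∏ i, D i := by rw [hdetD, hdetM]; exact hL
  have hD : ∀ i, D i ≠ 0 := fun i hi => by
    rw [Finset.prod_eq_zero (Finset.mem_univ i) hi] at hprod
    exact lt_irrefl _ hprod
  -- the negative entries come in pairs
  set s : Finset ι := Finset.univ.filter (fun i => D i < 0) with hs_def
  have habs : ∀ i, |D i| * (if i ∈ s then (-1 : ℝ) else 1) = D i := fun i => by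
    by_cases h : D i < 0
    · have : i ∈ s := by simp [hs_def, h]
      rw [if_pos this, abs_of_neg h]; ring
    · have : i ∉ s := by simp [hs_def, h]
      rw [if_neg this, abs_of_nonneg (not_lt.mp h), mul_one]
  have heven : Even s.card := by
    by_contra hodd
    rw [Nat.not_even_iff_odd] at hodd
    have h1 : (∏ i, D i) = (∏ i, |D i|) * ∏ i, (if i ∈ s then (-1 : ℝ) else 1) := by
      rw [← Finset.prod_mul_distrib]
      exact Finset.prod_congr rfl fun i _ => (habs i).symm
    have h2 : (∏ i, (if i ∈ s then (-1 : ℝ) else 1)) = (-1) ^ s.card := by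
      rw [Finset.prod_ite, Finset.prod_const, Finset.prod_const_one, mul_one]
      congr 1
      simp [hs_def]
    rw [h1, h2, hodd.neg_one_pow] at hprod
    have h3 : 0 ≤ ∏ i, |D i| := Finset.prod_nonneg fun i _ => abs_nonneg _
    nlinarith
  obtain ⟨m, hm⟩ := heven
  have hdiag : diagonal D = diagonal (fun i => |D i|) * diagonal (fun i => if i ∈ s then (-1 : ℝ) else 1) := by
    rw [diagonal_mul_diagonal]
    congr 1
    funext i
    exact (habs i).symm
  have hkey : (L : EuclideanSpace ℝ ι →L[ℝ] EuclideanSpace ℝ ι) =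
      T (P.map TransvectionStruct.toMatrix).prod * (T (diagonal fun i => |D i|) *
        (T (diagonal fun i => if i ∈ s then (-1 : ℝ) else 1) *
          T (P'.map TransvectionStruct.toMatrix).prod)) := by
    rw [← hTM, hMD, hdiag]
    simp only [map_mul, mul_assoc]
  rw [hkey]
  exact (isStraightenable_toEuclideanCLM_prod P).mul
    ((isStraightenable_toEuclideanCLM_diagonal fun i => abs_pos.mpr (hD i)).mul
      ((isStraightenable_toEuclideanCLM_diagonal_sign_aux m s (by omega)).mul
        (isStraightenable_toEuclideanCLM_prod P')))

end Literature.Topology.FourManifolds
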